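import Mathlib.MeasureTheory.Measure.Haar.InnerProductSpace
import Mathlib.MeasureTheory.Measure.Lebesgue.EqHaar
import Mathlib.MeasureTheory.Constructions.Pi
import Mathlib.MeasureTheory.Measure.Prod
import Mathlib.MeasureTheory.Measure.WithDensity
import Mathlib.MeasureTheory.Group.MeasurableEquiv
import Mathlib.MeasureTheory.Integral.IntervalIntegral.Basic
import Literature.Analysis.FluidPDE.HardSphereTimeScaling
import HarnessLib

/-!
# Thermal scaling of hard-sphere flows (helper, layer 2: flows and the Liouville measure)

Crux `Summit.AtomisticToContinuum.HydrodynamicLimit.Theses.AntiMazurCoboundaries.KineticWindowGronwall`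
(stmt-AtomisticToContinuum-9282), line `dlr-block-transfer` v4, helper toward the lead's stub `stub_blockTransfer`
(proof-plan step (1): "thermal scaling `(x, t) ↦ (x, t√θ)`, `v ↦ v/√θ` reduces every use of the kinetic hypothesis
to the frame `θ = 1`") and toward the shared crux stmt-10967 (`∀ θ` ⇐ `θ = 1`). Layer 1
(`…KineticWindowGronwallThermalScalingTrajectory`, registered stub `stub_trajectoryThermalScaling`) is the
trajectory-level symmetry, i.e. the tree's `IsHardSphereTrajectory.timeDilate`
(`Literature.Analysis.FluidPDE.HardSphereTimeScaling`); this file is self-contained and lifts it to FLOWS.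

THE CONSTRUCTION. For a hard-sphere flow `Φ : HardSphereFlow G ε N` (`HardSphereDynamics`: good set, group law,
measurable Liouville-preserving time-`t` maps whose good orbits are hard-sphere trajectories) and `c > 0`, the
TIME–VELOCITY RESCALED FLOW `thermalScale Φ c hc : HardSphereFlow G ε N` has
`flow t z := scaleVel c (Φ.flow (c * t) (scaleVel c⁻¹ z))`, `good := scaleVel c⁻¹ ⁻¹' Φ.good = scaleVel c '' Φ.good`.
Fields: the good set is measurable (`scaleVel` is measurable, indeed a measurable automorphism `scaleVelEquiv`), lies in
the hard-sphere domain (positions untouched), is invariant and carries the conjugated group law; good orbits are the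
time dilations `timeDilate c` of good orbits of `Φ` (layer 1); and the MEASURE THEORY: `scaleVel c` maps Lebesgue
measure on `(X × ℝ^d)^N` to the constant multiple `velJacobian d N c • volume`, `velJacobian d N c = (|c^d|⁻¹)^N`
(`Measure.map_addHaar_smul` on each velocity factor, `Measure.map_prod_map`, `Measure.pi_map_pi`), hence — the
hard-sphere domain being `scaleVel`-invariant — the Liouville measure to `velJacobian d N c • liouville`
(`map_scaleVel_liouville`); so Liouville-null sets are preserved (`measure_compl_good`) and
`scaleVel c ∘ Φ_{ct} ∘ scaleVel c⁻¹` preserves the Liouville measure, the Jacobians of `scaleVel c⁻¹` and `scaleVel c`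
cancelling (`velJacobian_inv_mul`). General geometry `G : Geometry d X` on a position measure space with σ-finite
`volume` (the flat torus `𝕋³` and `ℝ³` are instances).

CONTENTS: registered helper stub `stub_flowThermalScaling : FlowThermalScaling` (existence of the rescaled flow with
the explicit formula and good set); the torus form `flowThermalScaling_torus`; the API of `thermalScale`
(`thermalScale_flow`, `thermalScale_good(_eq_image)`, `thermalScale_flow_scaleVel`, `thermalScale_orbit`,
`lawAt_thermalScale(_map)`, transport of carried/invariant laws `map_scaleVel_thermalScale_good_compl`,
`measurePreserving_thermalScale_flow_map`, window functionals `intervalIntegral_thermalScale_flow`).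
-/

noncomputable section

open Set Filter Function MeasureTheory
open scoped ENNReal
open Literature.Analysis.FluidPDE

namespace Summit.AtomisticToContinuum.HydrodynamicLimit.Theorems.KineticWindowGronwallThermalScaling

section ScaleVel

variable {d : Type*} [Fintype d] {X : Type*} {N : ℕ}

omit [Fintype d] in
/-- `scaleVel c` undoes `scaleVel c⁻¹` (`c ≠ 0`). [folklore] -/
theorem scaleVel_scaleVel_inv {c : ℝ} (hc : c ≠ 0) (z : Config N d X) :
    scaleVel c (scaleVel c⁻¹ z) = z := by
  rw [scaleVel_scaleVel, mul_inv_cancel₀ hc, scaleVel_one]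

/-- The velocity scaling does not move the particles: `scaleVel c ⁻¹' D_ε^N = D_ε^N`. [folklore] -/
theorem preimage_scaleVel_hardSphereDomain (G : Geometry d X) (ε : ℝ) (c : ℝ) :
    scaleVel c ⁻¹' hardSphereDomain G N ε = hardSphereDomain G N ε := by
  ext z
  exact scaleVel_mem_hardSphereDomain_iff

/-- `scaleVel c` is measurable. [folklore] -/
theorem measurable_scaleVel [MeasurableSpace X] (c : ℝ) :
    Measurable (scaleVel c : Config N d X → Config N d X) :=
  measurable_pi_lambda _ fun i =>
    (measurable_pi_apply i).fst.prodMk ((measurable_pi_apply i).snd.const_smul c)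

/-- `scaleVel c`, `c ≠ 0`, as a measurable automorphism of phase space (inverse `scaleVel c⁻¹`). -/
def scaleVelEquiv [MeasurableSpace X] (c : ℝ) (hc : c ≠ 0) : Config N d X ≃ᵐ Config N d X where
  toFun := scaleVel c
  invFun := scaleVel c⁻¹
  left_inv := scaleVel_inv_scaleVel hc
  right_inv := scaleVel_scaleVel_inv hc
  measurable_toFun := measurable_scaleVel c
  measurable_invFun := measurable_scaleVel c⁻¹

/-- Unfolding lemma for `scaleVelEquiv`. [folklore] -/
@[simp]
theorem coe_scaleVelEquiv [MeasurableSpace X] {c : ℝ} (hc : c ≠ 0) :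
    ⇑(scaleVelEquiv (N := N) (d := d) (X := X) c hc) = scaleVel c := rfl

/-- The inverse of `scaleVelEquiv c` is `scaleVel c⁻¹`. [folklore] -/
@[simp]
theorem coe_scaleVelEquiv_symm [MeasurableSpace X] {c : ℝ} (hc : c ≠ 0) :
    ⇑(scaleVelEquiv (N := N) (d := d) (X := X) c hc).symm = scaleVel c⁻¹ := rfl

omit [Fintype d] in
/-- The image of a set under `scaleVel c` is its preimage under `scaleVel c⁻¹` (`c ≠ 0`). [folklore] -/
theorem image_scaleVel_eq_preimage {c : ℝ} (hc : c ≠ 0) (s : Set (Config N d X)) :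
    scaleVel c '' s = scaleVel c⁻¹ ⁻¹' s :=
  congrFun (Set.image_eq_preimage_of_inverse (scaleVel_inv_scaleVel hc) (scaleVel_scaleVel_inv hc)) s

/-! ### The Jacobian of the velocity scaling on the Liouville measure -/

/-- The Jacobian of `scaleVel c` on `N`-particle phase space with `d`-dimensional velocities:
`J = |c ^ dim|⁻¹` per particle, `velJacobian d N c = (|c ^ dim|⁻¹) ^ N` (as an extended nonnegative real), so that
`vol (scaleVel c ⁻¹' S) = velJacobian d N c * vol S`. -/
def velJacobian (d : Type*) [Fintype d] (N : ℕ) (c : ℝ) : ℝ≥0∞ :=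
  ENNReal.ofReal |(c ^ Fintype.card d)⁻¹| ^ N

/-- The Jacobians of `scaleVel c⁻¹` and `scaleVel c` cancel (`c ≠ 0`). [folklore] -/
theorem velJacobian_inv_mul {c : ℝ} (hc : c ≠ 0) (N : ℕ) :
    velJacobian d N c⁻¹ * velJacobian d N c = 1 := by
  rw [velJacobian, velJacobian, ← mul_pow, ← ENNReal.ofReal_mul (abs_nonneg _), ← abs_mul, inv_pow,
    inv_inv, mul_inv_cancel₀ (pow_ne_zero _ hc), abs_one, ENNReal.ofReal_one, one_pow]

/-- The Jacobian is finite. [folklore] -/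
theorem velJacobian_ne_top (N : ℕ) (c : ℝ) : velJacobian d N c ≠ ∞ :=
  ENNReal.pow_ne_top ENNReal.ofReal_ne_top

/-- The Jacobian is nonzero for `c ≠ 0`. [folklore] -/
theorem velJacobian_ne_zero {c : ℝ} (hc : c ≠ 0) (N : ℕ) : velJacobian d N c ≠ 0 := by
  intro h
  have := velJacobian_inv_mul (d := d) hc N
  rw [h, mul_zero] at this
  exact zero_ne_one this

variable [MeasureSpace X]

/-- One particle: `(x, v) ↦ (x, c v)` maps Lebesgue measure on `X × ℝ^d` to `|c^d|⁻¹ •` Lebesgue measure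
(`Measure.map_addHaar_smul` on the velocity factor). [folklore] -/
theorem map_prodMap_smul_volume [SigmaFinite (volume : Measure X)] {c : ℝ} (hc : c ≠ 0) :
    (volume : Measure (X × EuclideanSpace ℝ d)).map (Prod.map id fun v => c • v) =
      ENNReal.ofReal |(c ^ Fintype.card d)⁻¹| • (volume : Measure (X × EuclideanSpace ℝ d)) := by
  rw [Measure.volume_eq_prod, ← Measure.map_prod_map _ _ measurable_id (measurable_const_smul c), Measure.map_id,
    Measure.map_addHaar_smul volume hc, finrank_euclideanSpace, Measure.prod_smul_right]

/-- Products of a constant multiple: `⨂_{i<N} (k • μ) = k^N • ⨂_{i<N} μ` (both families σ-finite). [folklore] -/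
theorem pi_const_smul {α : Type*} [MeasurableSpace α] (μ : Measure α) [SigmaFinite μ] (k : ℝ≥0∞)
    (N : ℕ) [SigmaFinite (k • μ)] :
    Measure.pi (fun _ : Fin N => k • μ) = k ^ N • Measure.pi (fun _ : Fin N => μ) := by
  refine Measure.pi_eq (μ := fun _ : Fin N => k • μ) fun s _ => ?_
  rw [Measure.smul_apply, Measure.pi_pi, smul_eq_mul]
  simp only [Measure.smul_apply, smul_eq_mul]
  rw [Finset.prod_mul_distrib, Finset.prod_const, Finset.card_univ, Fintype.card_fin]

/-- **The Jacobian of the velocity scaling**: `scaleVel c` maps Lebesgue measure on `(X × ℝ^d)^N` to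
`velJacobian d N c •` Lebesgue measure (`c ≠ 0`, σ-finite `volume` on `X`). [folklore] -/
theorem map_scaleVel_volume [SigmaFinite (volume : Measure X)] {c : ℝ} (hc : c ≠ 0) :
    (volume : Measure (Config N d X)).map (scaleVel c) = velJacobian d N c • volume := by
  set g : X × EuclideanSpace ℝ d ≃ᵐ X × EuclideanSpace ℝ d :=
    MeasurableEquiv.prodCongr (MeasurableEquiv.refl X) (MeasurableEquiv.smul₀ c hc)
  have hgcoe : (⇑g) = Prod.map id fun v => c • v := rfl
  have hmap : (volume : Measure (X × EuclideanSpace ℝ d)).map g =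
      ENNReal.ofReal |(c ^ Fintype.card d)⁻¹| • (volume : Measure (X × EuclideanSpace ℝ d)) := by
    rw [hgcoe, map_prodMap_smul_volume hc]
  haveI hσ : SigmaFinite (volume : Measure (X × EuclideanSpace ℝ d)) := by
    rw [Measure.volume_eq_prod]; infer_instance
  haveI : SigmaFinite ((volume : Measure (X × EuclideanSpace ℝ d)).map g) := g.sigmaFinite_map
  haveI hk : SigmaFinite (ENNReal.ofReal |(c ^ Fintype.card d)⁻¹| •
      (volume : Measure (X × EuclideanSpace ℝ d))) := by
    rw [← hmap]; infer_instance
  have hsv : (scaleVel c : Config N d X → Config N d X) = fun z i => g (z i) := by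
    funext z i
    rfl
  rw [volume_pi, hsv, Measure.pi_map_pi fun _ => g.measurable.aemeasurable, hmap, pi_const_smul, velJacobian]

/-- **The velocity scaling multiplies the Liouville measure by its Jacobian**:
`(scaleVel c)_# (liouville G N ε) = velJacobian d N c • liouville G N ε` (positions untouched, so the hard-sphere
domain is invariant; `c ≠ 0`). [folklore] -/
theorem map_scaleVel_liouville [SigmaFinite (volume : Measure X)] (G : Geometry d X) (ε : ℝ) {c : ℝ}
    (hc : c ≠ 0) :
    (liouville G N ε).map (scaleVel c) = velJacobian d N c • liouville G N ε := by
  rw [liouville_eq]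
  calc (volume.restrict (hardSphereDomain G N ε)).map (scaleVel c)
      = (volume.restrict (scaleVel c ⁻¹' hardSphereDomain G N ε)).map (scaleVel c) := by
        rw [preimage_scaleVel_hardSphereDomain]
    _ = ((volume : Measure (Config N d X)).map (scaleVel c)).restrict (hardSphereDomain G N ε) := by
        have h := (scaleVelEquiv (N := N) c hc).restrict_map volume (hardSphereDomain G N ε)
        rw [coe_scaleVelEquiv] at h
        exact h.symm
    _ = velJacobian d N c • volume.restrict (hardSphereDomain G N ε) := by
        rw [map_scaleVel_volume hc, Measure.restrict_smul]

/-- `scaleVel c` is measure preserving from the Liouville measure to its Jacobian multiple. [folklore] -/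
theorem measurePreserving_scaleVel [SigmaFinite (volume : Measure X)] (G : Geometry d X) (ε : ℝ) {c : ℝ}
    (hc : c ≠ 0) :
    MeasurePreserving (scaleVel c) (liouville G N ε) (velJacobian d N c • liouville G N ε) :=
  ⟨measurable_scaleVel c, map_scaleVel_liouville G ε hc⟩

/-- The velocity scaling preserves Liouville-null sets. [folklore] -/
theorem liouville_preimage_scaleVel_eq_zero [SigmaFinite (volume : Measure X)] (G : Geometry d X) (ε : ℝ)
    {c : ℝ} (hc : c ≠ 0) {s : Set (Config N d X)} (hs : MeasurableSet s) (h0 : liouville G N ε s = 0) :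
    liouville G N ε (scaleVel c ⁻¹' s) = 0 := by
  rw [← Measure.map_apply (measurable_scaleVel c) hs, map_scaleVel_liouville G ε hc, Measure.smul_apply, h0,
    smul_zero]

end ScaleVel

/-! ### The thermally rescaled flow -/

section Flow

variable {d : Type*} [Fintype d] {X : Type*} [MeasureSpace X] [TopologicalSpace X]
  [SigmaFinite (volume : Measure X)] {G : Geometry d X} {ε : ℝ} {N : ℕ}

/-- **THE THERMALLY RESCALED HARD-SPHERE FLOW** `Φ^{(c)}_t = scaleVel c ∘ Φ_{ct} ∘ scaleVel c⁻¹` (`c > 0`): a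
hard-sphere flow for the SAME geometry and diameter, with good set `scaleVel c '' Φ.good = scaleVel c⁻¹ ⁻¹' Φ.good`.
Orbits are the time dilations `timeDilate c` of the orbits of `Φ` (`IsHardSphereTrajectory.timeDilate`); the group
law is conjugated; the Liouville measure is multiplied by the Jacobian `velJacobian d N c⁻¹` under `scaleVel c⁻¹`,
preserved by `Φ_{ct}`, and multiplied back by `velJacobian d N c` under `scaleVel c`. -/
def thermalScale (Φ : HardSphereFlow G ε N) (c : ℝ) (hc : 0 < c) : HardSphereFlow G ε N where
  flow t z := scaleVel c (Φ.flow (c * t) (scaleVel c⁻¹ z))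
  good := scaleVel c⁻¹ ⁻¹' Φ.good
  measurableSet_good := measurable_scaleVel c⁻¹ Φ.measurableSet_good
  good_subset _ hz := scaleVel_mem_hardSphereDomain_iff.1 (Φ.good_subset hz)
  measure_compl_good := by
    rw [← preimage_compl]
    exact liouville_preimage_scaleVel_eq_zero G ε (inv_ne_zero hc.ne') Φ.measurableSet_good.compl
      Φ.measure_compl_good
  mapsTo_good t z hz := by
    show scaleVel c⁻¹ (scaleVel c (Φ.flow (c * t) (scaleVel c⁻¹ z))) ∈ Φ.good
    rw [scaleVel_inv_scaleVel hc.ne']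
    exact Φ.mapsTo_good _ hz
  flow_zero z hz := by
    show scaleVel c (Φ.flow (c * 0) (scaleVel c⁻¹ z)) = z
    rw [mul_zero, Φ.flow_zero _ hz, scaleVel_scaleVel_inv hc.ne']
  flow_add s t z hz := by
    show scaleVel c (Φ.flow (c * (s + t)) (scaleVel c⁻¹ z)) =
      scaleVel c (Φ.flow (c * s) (scaleVel c⁻¹ (scaleVel c (Φ.flow (c * t) (scaleVel c⁻¹ z)))))
    rw [mul_add, Φ.flow_add _ _ _ hz, scaleVel_inv_scaleVel hc.ne']
  measurable_flow t := (measurable_scaleVel c).comp ((Φ.measurable_flow _).comp (measurable_scaleVel _))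
  isTrajectory z hz := (Φ.isTrajectory _ hz).timeDilate hc
  measurePreserving t := by
    have hK := velJacobian_inv_mul (d := d) hc.ne' N
    have h₁ : MeasurePreserving (scaleVel c⁻¹) (liouville G N ε) (velJacobian d N c⁻¹ • liouville G N ε) :=
      measurePreserving_scaleVel G ε (inv_ne_zero hc.ne')
    have h₂ : MeasurePreserving (Φ.flow (c * t)) (velJacobian d N c⁻¹ • liouville G N ε)
        (velJacobian d N c⁻¹ • liouville G N ε) := (Φ.measurePreserving (c * t)).smul_measure _
    have h₃ : MeasurePreserving (scaleVel c) (velJacobian d N c⁻¹ • liouville G N ε) (liouville G N ε) := by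
      have h := (measurePreserving_scaleVel (N := N) G ε hc.ne').smul_measure (velJacobian d N c⁻¹)
      rwa [smul_smul, hK, one_smul] at h
    exact h₃.comp (h₂.comp h₁)

variable (Φ : HardSphereFlow G ε N) {c : ℝ} (hc : 0 < c)

/-- The flow map of the rescaled flow. [folklore] -/
@[simp]
theorem thermalScale_flow (t : ℝ) (z : Config N d X) :
    (thermalScale Φ c hc).flow t z = scaleVel c (Φ.flow (c * t) (scaleVel c⁻¹ z)) := rfl

/-- The good set of the rescaled flow (preimage form). [folklore] -/
theorem thermalScale_good : (thermalScale Φ c hc).good = scaleVel c⁻¹ ⁻¹' Φ.good := rfl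

/-- The good set of the rescaled flow (image form). [folklore] -/
theorem thermalScale_good_eq_image : (thermalScale Φ c hc).good = scaleVel c '' Φ.good := by
  rw [thermalScale_good, image_scaleVel_eq_preimage hc.ne']

/-- Membership in the good set of the rescaled flow. [folklore] -/
theorem mem_thermalScale_good_iff {z : Config N d X} :
    z ∈ (thermalScale Φ c hc).good ↔ scaleVel c⁻¹ z ∈ Φ.good := Iff.rfl

/-- `scaleVel c` maps good data of `Φ` to good data of the rescaled flow. [folklore] -/
theorem scaleVel_mem_thermalScale_good_iff {z : Config N d X} :
    scaleVel c z ∈ (thermalScale Φ c hc).good ↔ z ∈ Φ.good := by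
  rw [mem_thermalScale_good_iff, scaleVel_inv_scaleVel hc.ne']

/-- **Conjugation identity**: `Φ^{(c)}_t (scaleVel c z) = scaleVel c (Φ_{ct} z)` for every `z` (`c > 0`). [folklore] -/
theorem thermalScale_flow_scaleVel (t : ℝ) (z : Config N d X) :
    (thermalScale Φ c hc).flow t (scaleVel c z) = scaleVel c (Φ.flow (c * t) z) := by
  rw [thermalScale_flow, scaleVel_inv_scaleVel hc.ne']

/-- The orbits of the rescaled flow are the time dilations of the orbits of `Φ`:
`t ↦ Φ^{(c)}_t (scaleVel c z) = timeDilate c (t ↦ Φ_t z)`. [folklore] -/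
theorem thermalScale_orbit (z : Config N d X) :
    (fun t => (thermalScale Φ c hc).flow t (scaleVel c z)) = timeDilate c fun t => Φ.flow t z := by
  funext t
  rw [thermalScale_flow_scaleVel, timeDilate_apply]

/-- Rescaling by `1` gives back the flow map. [folklore] -/
theorem thermalScale_one_flow : (thermalScale Φ 1 one_pos).flow = Φ.flow := by
  funext t z
  rw [thermalScale_flow, inv_one, scaleVel_one, one_mul, scaleVel_one]

/-- Rescaling by `1` gives back the good set. [folklore] -/
theorem thermalScale_one_good : (thermalScale Φ 1 one_pos).good = Φ.good := by
  rw [thermalScale_good, inv_one]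
  ext z
  rw [mem_preimage, scaleVel_one]

/-- Laws transported by the rescaled flow: `Φ^{(c)}` pushes `P` at time `t` to the `scaleVel c`-image of the law at
time `ct` of `Φ` started from `(scaleVel c⁻¹)_# P`. [folklore] -/
theorem lawAt_thermalScale (P : Measure (Config N d X)) (t : ℝ) :
    (thermalScale Φ c hc).lawAt P t = (Φ.lawAt (P.map (scaleVel c⁻¹)) (c * t)).map (scaleVel c) := by
  rw [HardSphereFlow.lawAt_eq, HardSphereFlow.lawAt_eq, Measure.map_map (Φ.measurable_flow _) (measurable_scaleVel _),
    Measure.map_map (measurable_scaleVel c) ((Φ.measurable_flow _).comp (measurable_scaleVel _))]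
  rfl

/-- Same, started from a `scaleVel c`-image law: `Φ^{(c)}` started from `(scaleVel c)_# P₀` has at time `t` the
`scaleVel c`-image of the law of `Φ` at time `ct` started from `P₀`. [folklore] -/
theorem lawAt_thermalScale_map (P₀ : Measure (Config N d X)) (t : ℝ) :
    (thermalScale Φ c hc).lawAt (P₀.map (scaleVel c)) t = (Φ.lawAt P₀ (c * t)).map (scaleVel c) := by
  rw [lawAt_thermalScale, Measure.map_map (measurable_scaleVel _) (measurable_scaleVel c)]
  have : (scaleVel c⁻¹ ∘ scaleVel c : Config N d X → Config N d X) = id :=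
    funext fun z => scaleVel_inv_scaleVel hc.ne' z
  rw [this, Measure.map_id]

/-- **Carried laws are carried**: if `P` is carried by the good set of `Φ` then `(scaleVel c)_# P` is carried by the
good set of the rescaled flow (indeed the two complements have the same mass). [folklore] -/
theorem map_scaleVel_thermalScale_good_compl (P : Measure (Config N d X)) :
    P.map (scaleVel c) (thermalScale Φ c hc).goodᶜ = P Φ.goodᶜ := by
  rw [Measure.map_apply (measurable_scaleVel c) (thermalScale Φ c hc).measurableSet_good.compl, thermalScale_good,
    ← preimage_compl, ← preimage_comp]
  have : (scaleVel c⁻¹ ∘ scaleVel c : Config N d X → Config N d X) = id :=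
    funext fun z => scaleVel_inv_scaleVel hc.ne' z
  rw [this, preimage_id]

/-- **Invariant laws are invariant**: if every `Φ_s` preserves `P` then every time-`t` map of the rescaled flow
preserves `(scaleVel c)_# P` (e.g. the homogeneous local Gibbs law at temperature `θ` and its image at temperature
`c² θ`). [folklore] -/
theorem measurePreserving_thermalScale_flow_map (P : Measure (Config N d X))
    (hinv : ∀ s : ℝ, MeasurePreserving (Φ.flow s) P P) (t : ℝ) :
    MeasurePreserving ((thermalScale Φ c hc).flow t) (P.map (scaleVel c)) (P.map (scaleVel c)) := by
  refine ⟨(thermalScale Φ c hc).measurable_flow t, ?_⟩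
  have h := lawAt_thermalScale_map Φ hc P t
  simp only [HardSphereFlow.lawAt_eq] at h
  rw [h, (hinv (c * t)).map_eq]

/-- **Window functionals along rescaled orbits** (change of variables `s ↦ c s` in time): for every observable `F`,
`∫_a^b F (Φ^{(c)}_s (scaleVel c z)) ds = c⁻¹ ∫_{ca}^{cb} F (scaleVel c (Φ_s z)) ds` — the window-`τ` functional of the
rescaled flow is the window-`cτ` functional of `Φ` for the rescaled observable `F ∘ scaleVel c`. [folklore] -/
theorem intervalIntegral_thermalScale_flow {E : Type*} [NormedAddCommGroup E] [NormedSpace ℝ E]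
    (F : Config N d X → E) (z : Config N d X) (a b : ℝ) :
    ∫ s in a..b, F ((thermalScale Φ c hc).flow s (scaleVel c z)) =
      c⁻¹ • ∫ s in (c * a)..(c * b), F (scaleVel c (Φ.flow s z)) := by
  simp only [thermalScale_flow_scaleVel]
  exact intervalIntegral.integral_comp_mul_left (fun s => F (scaleVel c (Φ.flow s z))) hc.ne'

end Flow

/-! ### The registered statement -/

/-- **THERMAL SCALING OF HARD-SPHERE FLOWS.** For every geometry `G` on a position measure space `X` with σ-finite
`volume`, every diameter `ε`, particle number `N`, hard-sphere flow `Φ : HardSphereFlow G ε N` and `c > 0`, there is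
a hard-sphere flow `Ψ` (same geometry, same diameter) with flow map `Ψ_t z = scaleVel c (Φ_{ct} (scaleVel c⁻¹ z))`
for all `t, z` and good set `scaleVel c '' Φ.good` — the time–velocity rescaled dynamics is again an a.e. defined,
measurable, Liouville-preserving group of hard-sphere trajectories. The thermal reduction of the block transfer is
`c = (√θ)⁻¹`. Folklore (dimensional analysis; Liouville measure scales by the constant Jacobian `|c|^{-dN}`). -/
def FlowThermalScaling : Prop :=
  ∀ {d : Type*} [Fintype d] {X : Type*} [MeasureSpace X] [TopologicalSpace X] [SigmaFinite (volume : Measure X)]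
    {G : Geometry d X} {ε : ℝ} {N : ℕ} (Φ : HardSphereFlow G ε N) (c : ℝ), 0 < c →
    ∃ Ψ : HardSphereFlow G ε N,
      (∀ t z, Ψ.flow t z = scaleVel c (Φ.flow (c * t) (scaleVel c⁻¹ z))) ∧ Ψ.good = scaleVel c '' Φ.good

/-- **Layer 2, proved**: `stub_flowThermalScaling` (witness `thermalScale`). [folklore] -/
theorem stub_flowThermalScaling : FlowThermalScaling := by
  intro d _ X _ _ _ G ε N Φ c hc
  exact ⟨thermalScale Φ c hc, fun t z => rfl, thermalScale_good_eq_image Φ hc⟩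

/-- **The torus case** `𝕋³ × ℝ³` in the form used by the block transfer: for every hard-sphere flow on the flat
3-torus and `c > 0` there is a hard-sphere flow `Ψ` with `Ψ_t z = scaleVel c (Φ_{ct} (scaleVel c⁻¹ z))`. [folklore] -/
theorem flowThermalScaling_torus (ε : ℝ) (N : ℕ) (Φ : HardSphereFlow (Torus.geometry (Fin 3)) ε N) (c : ℝ)
    (hc : 0 < c) :
    ∃ Ψ : HardSphereFlow (Torus.geometry (Fin 3)) ε N,
      ∀ t z, Ψ.flow t z = scaleVel c (Φ.flow (c * t) (scaleVel c⁻¹ z)) :=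
  ⟨thermalScale Φ c hc, fun _ _ => rfl⟩

end Summit.AtomisticToContinuum.HydrodynamicLimit.Theorems.KineticWindowGronwallThermalScaling

end
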